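import Summits.Ventures.Crystal3D.Theorems.StickyWulffConstantStackingLiminfClassCounts
import Summits.Ventures.Crystal3D.Theorems.StickyWulffConstantStackingLiminfRungSmoothMass
import Summits.Ventures.Crystal3D.Theorems.StickyWulffConstantStackingLiminfRungTranslateL1
import HarnessLib

/-!
# S1 of stub (B) `MollifiedUpper` (line LayerChain v4, crux `StackingLiminf`, stmt-Ventures-19145):
# the per-class sharp `L¹` bound `Σ_classes ‖v_k(· − c) − v_{k'}‖₁ ≤ √2 · D`

Cell `crystal3d-full`, venture `Summits/Ventures/Crystal3D`.  BLUEPRINT-v4B (S1), now in the kernel: for an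
injective configuration `x` in the Barlow stacking of a Hägg word `σ` (layer map `kf`), mollified at scale
`K` by `bump K` (mass `1/√2`, R1 p507991), and ANY finite set of layers `KS`,

`Σ_{k ∈ KS} Σ_{m<3} ( ‖v_k(· − aVec m) − v_k‖₁ + ‖v_k(· − b_{σ k,m}) − v_{k+1}‖₁ ) ≤ √2 · (6N − numContacts x)`,

where `v_k = Σ_{i : kf i = k} φ_K(· − x_i)` is the mollified density of layer `k` and `b_{1,m} = bPlus m`,
`b_{−1,m} = bMinus m`.  Proof: the sharp triangle inequality with cancellation (R3 `rung_sum_translate_sub_l1`,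
p504959) per class, the unmatched centres being vacant slots (`sum_classUnmatched_le`, `…ClassCounts.lean`),
of which there are `12N − 2·numContacts = 2D` (`…TwelveSlots.lean`).  This is the exact-constant front end
of stub (B); the remaining steps are S2 (Taylor, `C N/K²`), S3 (two-phase pairing: R4 p505254 +
`stub_calibration`), S4 (skew bound).  WHAT THIS IS NOT: stub (B) itself.
-/

noncomputable section

namespace Summit.Ventures.Crystal3D.Theorems

open MeasureTheory Set
open Literature.MathematicalPhysics.StatisticalMechanics
open Summit.Ventures.Crystal3D.LayerChain (aVec bPlus bMinus)
open Summit.Ventures.Crystal3D.Cruxes.StackingLiminf.LayerChainV4 (bump)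

/-- One bond class: the `L¹` distance of the two translated sums of bumps is at most the number of
unmatched centres times `1/√2`. -/
theorem class_l1_le {K : ℝ} (hK : 0 < K) (P Q : Finset (EuclideanSpace ℝ (Fin 3))) :
    ∫ y : Fin 3 → ℝ, |∑ p ∈ P, bump K (y - WithLp.ofLp p) - ∑ q ∈ Q, bump K (y - WithLp.ofLp q)| ≤
      (((P \ Q).card + (Q \ P).card : ℕ) : ℝ) * (1 / Real.sqrt 2) := by
  have hinj : Function.Injective (WithLp.ofLp : EuclideanSpace ℝ (Fin 3) → (Fin 3 → ℝ)) :=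
    WithLp.ofLp_injective 2
  have hI : Integrable (bump K) :=
    (continuous_bump K).integrable_of_hasCompactSupport (hasCompactSupport_bump hK)
  have h := rung_sum_translate_sub_l1 (P.image WithLp.ofLp) (Q.image WithLp.ofLp) (bump K)
    (bump_nonneg hK) hI
  have e : (fun y : Fin 3 → ℝ => |∑ p ∈ P.image WithLp.ofLp, bump K (y - p) -
      ∑ q ∈ Q.image WithLp.ofLp, bump K (y - q)|) =
      fun y => |∑ p ∈ P, bump K (y - WithLp.ofLp p) - ∑ q ∈ Q, bump K (y - WithLp.ofLp q)| := by
    funext y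
    rw [Finset.sum_image hinj.injOn, Finset.sum_image hinj.injOn]
  rw [e, ← Finset.image_sdiff P Q hinj, ← Finset.image_sdiff Q P hinj,
    Finset.card_image_of_injective _ hinj, Finset.card_image_of_injective _ hinj,
    rung_integral_bump K hK] at h
  exact h

open scoped Classical in
/-- **S1 — the per-class sharp `L¹` bound.**  Summed over any finite set of layers `KS` and the three vectors
of each family, the `L¹` distances between the translated layer densities are at most `√2 · (6N − #contacts)`. -/
theorem sum_class_l1_le {σ : ℤ → ℤ} (hσ : IsHaggSeq σ) {N : ℕ}
    (x : Fin N → EuclideanSpace ℝ (Fin 3)) (hx : Function.Injective x)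
    (hmem : ∀ i, x i ∈ barlowStacking 1 (Real.sqrt (2 / 3)) σ) (kf : Fin N → ℤ)
    (hkf : ∀ i, x i 2 = kf i * Real.sqrt (2 / 3)) {K : ℝ} (hK : 0 < K) (KS : Finset ℤ) :
    ∑ k ∈ KS, ∑ m : Fin 3,
      ((∫ y : Fin 3 → ℝ, |(∑ i ∈ Finset.univ.filter (fun i => kf i = k),
            bump K (y - WithLp.ofLp (x i + WithLp.toLp 2 (aVec m)))) -
          ∑ i ∈ Finset.univ.filter (fun i => kf i = k), bump K (y - WithLp.ofLp (x i))|) +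
        ∫ y : Fin 3 → ℝ, |(∑ i ∈ Finset.univ.filter (fun i => kf i = k),
            bump K (y - WithLp.ofLp (x i + WithLp.toLp 2 (if σ k = 1 then bPlus m else bMinus m)))) -
          ∑ i ∈ Finset.univ.filter (fun i => kf i = k + 1), bump K (y - WithLp.ofLp (x i))|) ≤
      Real.sqrt 2 * (6 * (N : ℝ) - (Summit.Ventures.Crystal3D.numContacts x : ℝ)) := by
  -- translated layer sums as sums over image finsets
  have hsum : ∀ (L : Finset (Fin N)) (v : EuclideanSpace ℝ (Fin 3)) (y : Fin 3 → ℝ),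
      ∑ i ∈ L, bump K (y - WithLp.ofLp (x i + v)) =
        ∑ p ∈ L.image (fun i => x i + v), bump K (y - WithLp.ofLp p) := by
    intro L v y
    rw [Finset.sum_image]
    intro i _ i' _ h
    exact hx (add_right_cancel h)
  have hsum0 : ∀ (L : Finset (Fin N)) (y : Fin 3 → ℝ),
      ∑ i ∈ L, bump K (y - WithLp.ofLp (x i)) = ∑ p ∈ L.image x, bump K (y - WithLp.ofLp p) := by
    intro L y
    rw [Finset.sum_image fun i _ i' _ h => hx h]
  -- the per-class unmatched-centre count (as in `sum_classUnmatched_le`)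
  set cnt : ℤ → Fin 3 → ℕ := fun k m =>
      ((((Finset.univ.filter fun i => kf i = k).image fun i => x i + WithLp.toLp 2 (aVec m)) \
            ((Finset.univ.filter fun i => kf i = k).image x)).card +
        (((Finset.univ.filter fun i => kf i = k).image x) \
            ((Finset.univ.filter fun i => kf i = k).image fun i => x i + WithLp.toLp 2 (aVec m))).card +
        (((Finset.univ.filter fun i => kf i = k).image fun i =>
              x i + WithLp.toLp 2 (if σ k = 1 then bPlus m else bMinus m)) \
            ((Finset.univ.filter fun i => kf i = k + 1).image x)).card +
        (((Finset.univ.filter fun i => kf i = k + 1).image x) \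
            ((Finset.univ.filter fun i => kf i = k).image fun i =>
              x i + WithLp.toLp 2 (if σ k = 1 then bPlus m else bMinus m))).card) with hcnt
  have hcount : (∑ k ∈ KS, ∑ m : Fin 3, cnt k m) + 2 * Summit.Ventures.Crystal3D.numContacts x ≤ 12 * N := by
    simpa only [hcnt] using sum_classUnmatched_le hσ x hx hmem kf hkf KS
  -- per class
  have hcl : ∀ (k : ℤ) (m : Fin 3),
      ((∫ y : Fin 3 → ℝ, |(∑ i ∈ Finset.univ.filter (fun i => kf i = k),
            bump K (y - WithLp.ofLp (x i + WithLp.toLp 2 (aVec m)))) -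
          ∑ i ∈ Finset.univ.filter (fun i => kf i = k), bump K (y - WithLp.ofLp (x i))|) +
        ∫ y : Fin 3 → ℝ, |(∑ i ∈ Finset.univ.filter (fun i => kf i = k),
            bump K (y - WithLp.ofLp (x i + WithLp.toLp 2 (if σ k = 1 then bPlus m else bMinus m)))) -
          ∑ i ∈ Finset.univ.filter (fun i => kf i = k + 1), bump K (y - WithLp.ofLp (x i))|) ≤
      (cnt k m : ℝ) * (1 / Real.sqrt 2) := by
    intro k m
    have hA := class_l1_le hK ((Finset.univ.filter fun i => kf i = k).image fun i =>
      x i + WithLp.toLp 2 (aVec m)) ((Finset.univ.filter fun i => kf i = k).image x)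
    have hB := class_l1_le hK ((Finset.univ.filter fun i => kf i = k).image fun i =>
      x i + WithLp.toLp 2 (if σ k = 1 then bPlus m else bMinus m))
      ((Finset.univ.filter fun i => kf i = k + 1).image x)
    simp_rw [← hsum, ← hsum0] at hA hB
    simp only [hcnt]
    push_cast at hA hB ⊢
    linarith
  -- sum the classes and use the slot count
  have hS : (0 : ℝ) < Real.sqrt 2 := Real.sqrt_pos.2 (by norm_num)
  have htwo : Real.sqrt 2 * Real.sqrt 2 = 2 := Real.mul_self_sqrt (by norm_num)
  have h2C : 2 * Summit.Ventures.Crystal3D.numContacts x ≤ 12 * N := le_trans (Nat.le_add_left _ _) hcount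
  calc _ ≤ ∑ k ∈ KS, ∑ m : Fin 3, (cnt k m : ℝ) * (1 / Real.sqrt 2) :=
        Finset.sum_le_sum fun k _ => Finset.sum_le_sum fun m _ => hcl k m
    _ = ((∑ k ∈ KS, ∑ m : Fin 3, cnt k m : ℕ) : ℝ) * (1 / Real.sqrt 2) := by
        push_cast
        rw [Finset.sum_mul]
        refine Finset.sum_congr rfl fun k _ => ?_
        rw [Finset.sum_mul]
    _ ≤ ((12 * N - 2 * Summit.Ventures.Crystal3D.numContacts x : ℕ) : ℝ) * (1 / Real.sqrt 2) := by
        gcongr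
        omega
    _ = Real.sqrt 2 * (6 * (N : ℝ) - (Summit.Ventures.Crystal3D.numContacts x : ℝ)) := by
        rw [Nat.cast_sub h2C]
        push_cast
        field_simp
        nlinarith [htwo]

end Summit.Ventures.Crystal3D.Theorems

end
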